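import Mathlib
import HarnessLib
import Literature.NumberTheory.LFunctions.ZetaScrew
import Summits.RiemannHypothesis.RiemannHypothesis.Theorems.IntegerScrewKNodeGain
import Summits.RiemannHypothesis.RiemannHypothesis.Theorems.IntegerScrewKNodeForm

/-!
# Route `IntegerScrew` — the `K`-NODE FLOOR of the pivot deficit: `G(M)·log M ≥ S_K − o(1)`
# (PIVOT-LAW §15.3, DERIVED → THEOREM for every `K`; RH-FREE given `S_{M−1} ≻ 0`)

With `L(M) = M·2Ψ(h_M)` and the deficit `G(M) = L(M) − M·d_M` of the pivot law (`m·d_m = L − G`): the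
trial inequality `IntegerScrewKNodeForm.screwPivot_le_incrementForm` (`d_M ≤` the increment Gram form,
needs `S_{M−1} ≻ 0`) at the coefficients `t_0 = 1`, `t_k = −(c_k/2)/log M`, and the limit
`IntegerScrewKNodeGain.eventually_kNode_trialGain_ge` (the gain of that trial vector `× log M` is
eventually `≥ S_K − ε`; `Ψ` on the wall only) give

* `eventually_kNode_deficit_floor` : for every `K` and `ε > 0`, eventually in `M`,
  `S_{M−1} ≻ 0 → S_K − ε ≤ G(M)·log M`, `S_K = Σ_{k=1}^{K}(c_k/2)²`,
  `c_k/2 = −½((k+1)log(k+1) − 2k log k + (k−1)log(k−1))`.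

`S_1 = (log 2)² = 0.4805` (the two-node gain of PIVOT-LAW §2a(iv)), `S_12 = 0.6294`,
`S_K ↑ ¼Σ_{k≥1}(Δ²[k log k])² = 0.6493591 = V/2`, the Szegő continuum constant (§15.4); the sharpness
(`IntegerScrewKNodeSharp`) makes `S_K/log M` the exact local gain.  Lower bounds on `G` point away from RH
(RH ⇔ `G(M) < L(M)` for all `M`).  Nothing here bears on the truth of RH. [Suzuki2023, (1.1), (1.4)]
-/

noncomputable section

-- D-0017: `Summit.<S>.<S>.…` is the designed namespace of a single-problem summit.
set_option linter.dupNamespace false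

namespace Summit.RiemannHypothesis.RiemannHypothesis.Theorems.IntegerScrew

open Literature.NumberTheory.LFunctions Filter Finset
open scoped Topology

/-- **THE `K`-NODE FLOOR OF THE PIVOT DEFICIT** (PIVOT-LAW §15.3).  For every `K` and every `ε > 0`,
eventually in `M`: `S_{M−1} ≻ 0 → S_K − ε ≤ G(M)·log M`, `G(M) = M·(2Ψ(log(M/(M−1))) − d_M)`,
`S_K = Σ_{k=1}^{K}(c_k/2)²`. [folklore] -/
theorem eventually_kNode_deficit_floor (K : ℕ) (ε : ℝ) (hε : 0 < ε) :
    ∀ᶠ M : ℕ in atTop, (screwMatrix (M - 2)).PosDef →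
      (∑ k ∈ Finset.Icc 1 K, (-((((k : ℕ) : ℝ) + 1) * Real.log (((k : ℕ) : ℝ) + 1) - 2 * ((((k : ℕ) : ℝ)) * Real.log ((k : ℕ) : ℝ))
            + ((((k : ℕ) : ℝ)) - 1) * Real.log ((((k : ℕ) : ℝ)) - 1)) / 2) ^ 2) - ε ≤
        (M : ℝ) * (2 * zetaScrew (Real.log ((M : ℝ) / ((M : ℝ) - 1))) - screwPivot M)
          * Real.log (M : ℝ) := by
  filter_upwards [eventually_kNode_trialGain_ge K ε hε, eventually_ge_atTop (K + 3)]
    with M hgain hMK hPD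
  -- the trial coefficients
  set σ : ℕ → ℝ := (fun a : ℕ => if a = 0 then (0 : ℝ) else if a = 1 then 1 else if a ≤ K + 1 then
          -(-((((a - 1 : ℕ) : ℝ) + 1) * Real.log (((a - 1 : ℕ) : ℝ) + 1) - 2 * ((((a - 1 : ℕ) : ℝ)) * Real.log ((a - 1 : ℕ) : ℝ))
            + ((((a - 1 : ℕ) : ℝ)) - 1) * Real.log ((((a - 1 : ℕ) : ℝ)) - 1)) / 2) / Real.log (M : ℝ) else 0) with hσdef
  have hσ0 : σ 0 = 0 := by simp [hσdef]
  have hσ1 : σ 1 = 1 := by simp [hσdef]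
  have hσK : σ (K + 2) = 0 := by
    simp only [hσdef, show K + 2 ≠ 0 by omega, show K + 2 ≠ 1 by omega,
      show ¬ (K + 2 ≤ K + 1) by omega, if_false]
  have hA := screwPivot_le_incrementForm M K hMK hPD σ hσ0 hσ1 hσK
  -- W_0 = M·B_M(0,0) = M·2Ψ(log(M/(M−1)))
  have hM3 : (3 : ℝ) ≤ (M : ℝ) := by exact_mod_cast (show 3 ≤ M by omega)
  have hM1 : 0 < (M : ℝ) - 1 := by linarith
  have hM0 : 0 < (M : ℝ) := by linarith
  have hL0 : 0 < Real.log (M : ℝ) := Real.log_pos (by linarith)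
  have hW : (M : ℝ) * (2 * zetaScrew (Real.log ((M : ℝ) / ((M : ℝ) - 1)))) = (M : ℝ) * (zetaScrew (Real.log ((M : ℝ) - ((0 : ℕ) : ℝ)) - Real.log ((M : ℝ) - (((0 : ℕ) : ℝ) + 1)))
        + zetaScrew (Real.log ((M : ℝ) - (((0 : ℕ) : ℝ) + 1)) - Real.log ((M : ℝ) - ((0 : ℕ) : ℝ)))
        - zetaScrew (Real.log ((M : ℝ) - ((0 : ℕ) : ℝ)) - Real.log ((M : ℝ) - ((0 : ℕ) : ℝ)))
        - zetaScrew (Real.log ((M : ℝ) - (((0 : ℕ) : ℝ) + 1)) - Real.log ((M : ℝ) - (((0 : ℕ) : ℝ) + 1)))) := by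
    simp only [Nat.cast_zero, sub_zero, zero_add, sub_self, zetaScrew_zero]
    rw [Real.log_div hM0.ne' hM1.ne', zetaScrew_sub_comm (Real.log ((M : ℝ) - 1)) (Real.log (M : ℝ))]
    ring
  -- assemble
  have h2 := mul_le_mul_of_nonneg_left hA hM0.le
  have e := mul_sub (M : ℝ) (2 * zetaScrew (Real.log ((M : ℝ) / ((M : ℝ) - 1)))) (screwPivot M)
  have hle : ((M : ℝ) * (zetaScrew (Real.log ((M : ℝ) - ((0 : ℕ) : ℝ)) - Real.log ((M : ℝ) - (((0 : ℕ) : ℝ) + 1)))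
        + zetaScrew (Real.log ((M : ℝ) - (((0 : ℕ) : ℝ) + 1)) - Real.log ((M : ℝ) - ((0 : ℕ) : ℝ)))
        - zetaScrew (Real.log ((M : ℝ) - ((0 : ℕ) : ℝ)) - Real.log ((M : ℝ) - ((0 : ℕ) : ℝ)))
        - zetaScrew (Real.log ((M : ℝ) - (((0 : ℕ) : ℝ) + 1)) - Real.log ((M : ℝ) - (((0 : ℕ) : ℝ) + 1))))
      - (M : ℝ) * ∑ j ∈ range (K + 1), ∑ k ∈ range (K + 1), σ (j + 1) * σ (k + 1) * (zetaScrew (Real.log ((M : ℝ) - (j : ℝ)) - Real.log ((M : ℝ) - ((k : ℝ) + 1)))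
        + zetaScrew (Real.log ((M : ℝ) - ((j : ℝ) + 1)) - Real.log ((M : ℝ) - (k : ℝ)))
        - zetaScrew (Real.log ((M : ℝ) - (j : ℝ)) - Real.log ((M : ℝ) - (k : ℝ)))
        - zetaScrew (Real.log ((M : ℝ) - ((j : ℝ) + 1)) - Real.log ((M : ℝ) - ((k : ℝ) + 1)))))
      ≤ (M : ℝ) * (2 * zetaScrew (Real.log ((M : ℝ) / ((M : ℝ) - 1))) - screwPivot M) := by
    linarith [hW, h2, e]
  exact hgain.trans (mul_le_mul_of_nonneg_right hle hL0.le)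

/-- Under RH the definiteness proviso is automatic (`screwMatrix_posDef_of_riemannHypothesis`): for
every `K`, `ε > 0`, eventually `S_K − ε ≤ G(M)·log M`. [folklore] -/
theorem eventually_kNode_deficit_floor_of_riemannHypothesis (hRH : _root_.RiemannHypothesis) (K : ℕ)
    (ε : ℝ) (hε : 0 < ε) :
    ∀ᶠ M : ℕ in atTop,
      (∑ k ∈ Finset.Icc 1 K, (-((((k : ℕ) : ℝ) + 1) * Real.log (((k : ℕ) : ℝ) + 1) - 2 * ((((k : ℕ) : ℝ)) * Real.log ((k : ℕ) : ℝ))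
            + ((((k : ℕ) : ℝ)) - 1) * Real.log ((((k : ℕ) : ℝ)) - 1)) / 2) ^ 2) - ε ≤
        (M : ℝ) * (2 * zetaScrew (Real.log ((M : ℝ) / ((M : ℝ) - 1))) - screwPivot M)
          * Real.log (M : ℝ) :=
  (eventually_kNode_deficit_floor K ε hε).mono fun M hM =>
    hM (screwMatrix_posDef_of_riemannHypothesis hRH (M - 2))

end Summit.RiemannHypothesis.RiemannHypothesis.Theorems.IntegerScrew
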